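import Summits.BirchSwinnertonDyer.BirchSwinnertonDyer.Theses.ErratumRoadFive
import Summits.BirchSwinnertonDyer.BirchSwinnertonDyer.Theorems.ErratumRoadFiveEulerHalfNotRamRung129360cy1LocalData
import Summits.BirchSwinnertonDyer.BirchSwinnertonDyer.Theorems.ErratumRoadFiveEulerHalfNotRamInertUpToOneTwo
import Summits.BirchSwinnertonDyer.BirchSwinnertonDyer.Theorems.ErratumRoadFiveEulerHalfNotRamInertSavedOfCarrierLabels
import Summits.BirchSwinnertonDyer.BirchSwinnertonDyer.Theorems.ClassRecordThreeEulerHalvesAtThreePoitouTateOfCanonical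
import Literature.NumberTheory.EllipticCurves.QuadraticTwistLocalDataAtTwoHoldsProofs
import HarnessLib

/-!
# Route `ErratumRoadFive`, crux `EulerHalfNotRamNoInertSetAtFive` (item stmt-BirchSwinnertonDyer-19715), line `birth` (v10) —
# THE KERNEL RUNG AT THE ONE CENSUS PAIR OF THE UP-TO-ONE ROAD: (129360cy1, 5), modulo the route items + ONE typed display

Cell `bsd-stepL`, seat `bsd-line-er5-p1-w3` (D-0154 extra width seat on crux 19715, lead `bsd-line-er5-p1`), `--supports stmt-BirchSwinnertonDyer-19715`.
THEOREMS ONLY, ONE curve: `E = [0,1,0,−615785,185776275]` = Cremona **129360cy1** (`N = 2⁴·3·5·7²·11`; kernel local data in the companion file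
`…Rung129360cy1LocalData.lean`: `3, 5, 11` split `5`-carriers, `2, 7` additive, `¬ Ram E 5`, `5 ∣ ∏c`, NO inert set, NO split-set datum, the
up-to-one₂ datum `q₁ = 11`, `S = {3, 5}`, `R = {5}`). The lead's OWED item (4) of line `birth` ∕ lead g1's invitation (a) (HOME/STATUS 10:46:32Z).

THE RUNG (§3): `Typed.MissingUpperBoundAt E 5` — the crux's conclusion at this pair — from `ClassX11b E 5` ALONE (analytic rank one at the
multiplicative `5`; Cremona: `r = 1`), GIVEN the route items `PublishedInputsFive` (19066: GZK, modularity, newform, Friedberg–Hoffstein, Mazur),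
`X11aLowerHalf` (19064), `ShimuraParametrizationDataNonempty` (19524), `PastenComponentOrdersInput`, and ONE typed display
`Theorems.ShimuraInertSavedDisplayAtD E 5 11` (the SAVED inert display at the exempted carrier; image-free, so no `Surj` binder at this level) —
-w2's pair-level up-to-one₂ road `missingUpperBoundAt_of_classX11b_of_not_ram_of_upToOne₂_of_savedDisplayD` (p624790 §1) at the kernel datum;
Barrios et al.'s `c₂` fact enters as the tree THEOREM `…two_mem_of_goodReduction_holds`. Second form: the display DERIVED exactly as the registered
skeleton v10 does — from the item `ShimuraCasselsTateLevelInputs`, conjunct (2) of the CITABLE stub `stub_printFactsHeld` (SelmerComplement of THE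
canonical invariant maps ⟹ Poitou–Tate, tam3-p1's `Koly.poitouTate_conj_forall_of_selmerComplement_canonical`) and the registered typed stub
`stub_shimuraCarrierLabelsB6AtFive` (its TEXT VERBATIM as the binder `hLabT`; -w2's `shimuraInertSavedDisplayAtD_of_carrierLabelsB6_of_five_le`, p624474).
Then the crux's own text at `(E, 5)` (the shape of the registered rungs `stub_rung_res_8085y1` ∕ `stub_rung_res_605a1`) and the S2-shaped text follow,
their binders `Surj` ∕ `¬ Ram` ∕ `5 ∣ ∏c` ∕ «∃ multiplicative ℓ ≠ 5» ∕ «no inert datum» unused (all but `Surj` are THEOREMS of the companion file,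
`Rung129360cy1.binders_hold`: the rung is not vacuous modulo `ClassX11b` ∕ `Surj`).

With this file EVERY piece of line `birth` has a kernel rung at its smallest census pair: road (8085y1, 5) [-w2 p613003], S1b (605a1, 5)
[lead p615583 §4], S2b′ (129360cy1, 5) [this file].

HONEST FRAMING: CONDITIONAL on the items (OPEN: `X11aLowerHalf`; typed-not-proved: the printed inputs, `casselsTate_levelInputs`, the (B6)-labelled
CM family) — a helper `--supports` 19715, not a closure; BSD(129360cy1, 5) is NOT proved by this (it would also need `ClassX11b E 5` certified and
the items themselves); nothing is booked; no summit statement is touched; no definition, no named fact, no `sorry`, no kit.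

References: [Cremona1997] Table 1 ∕ ecdata (curve 129360cy1); [Jetchev2008] Thm. 1.1, Cor. 1.5; [Kim2022HigherGZ] Rem. 7.9; [PastenShimura2024]
§6.6, Lemma 6.18; [PapikianRabinoff2016] Cor. 3.5; [MilneADT2006] Ch. I Prop. 3.8, Thm. 4.10(b); [GrossZagier1986Heegner] III (3.1);
[CaiShuTian2014] Thm. 1.5; [Zhang2001Heights] §4.4 Prop. 4.4.2.
-/

noncomputable section

open scoped Classical NumberField

open WeierstrassCurve NumberField IsDedekindDomain Literature.NumberTheory.EllipticCurves
  Literature.NumberTheory.EllipticCurves.Rank1Residual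
  Literature.NumberTheory.EllipticCurves.Rank1Residual.Typed
  Summit.BirchSwinnertonDyer.Rank1Residual Summit.BirchSwinnertonDyer.Rank1Residual.X11b
  Summit.BirchSwinnertonDyer.BirchSwinnertonDyer.Rank1Residual
  Summit.BirchSwinnertonDyer.BirchSwinnertonDyer.Theses.ErratumRoadFive

-- the cell's Theorems namespace repeats the summit name (Summit.<Summit>.<Problem>), as in every sibling file
set_option linter.dupNamespace false

namespace Summit.BirchSwinnertonDyer.BirchSwinnertonDyer.Theorems.EulerHalfInertUpToOne.Rung129360cy1

/-! ### §3 The rungs: the crux's conclusion at (129360cy1, 5) on the up-to-one₂ road, modulo the route items + ONE typed display -/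

/-- **`Typed.MissingUpperBoundAt E 5` for `E` = 129360cy1 from `ClassX11b E 5` ALONE, GIVEN the route items `PublishedInputsFive` (GZK, modularity,
newform, Friedberg–Hoffstein, Mazur), `X11aLowerHalf`, `ShimuraParametrizationDataNonempty`, `PastenComponentOrdersInput` and the ONE typed display
`Theorems.ShimuraInertSavedDisplayAtD E 5 11`** (the saved inert display at the exempted carrier `q₁ = 11`; image-free, so no `Surj` binder is
needed at this level): -w2's pair-level up-to-one₂ road (p624790 §1) at the kernel datum `S = {3, 5}`, `R = {5}` and the kernel facts `split_eleven`,
`not_ram_five`; Barrios et al.'s `c₂` fact is the tree theorem `…two_mem_of_goodReduction_holds`. CONDITIONAL; nothing booked.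
[cite: Jetchev2008, Thm. 1.1, Cor. 1.5] [cite: Kim2022HigherGZ, Rem. 7.9] [cite: PastenShimura2024, §6.6, Lemma 6.18] [cite: Cremona1997, Table 1 (curve 129360cy1)] -/
theorem missingUpperBoundAt_of_items_of_savedDisplayAtD (h₅ : PublishedInputsFive) (h₃ : X11aLowerHalf)
    (hJL : ShimuraParametrizationDataNonempty) (hCO : PastenComponentOrdersInput)
    [Fact (Nat.Prime 5)] [Fact (Nat.Prime 11)] [((⟨0, 1, 0, -615785, 185776275⟩ : WeierstrassCurve ℤ).baseChange ℚ).IsElliptic] [((⟨0, 1, 0, -615785, 185776275⟩ : WeierstrassCurve ℤ).baseChange ℚ).IsGloballyMinimal]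
    (hX : ClassX11b ((⟨0, 1, 0, -615785, 185776275⟩ : WeierstrassCurve ℤ).baseChange ℚ) 5) (hSavD : ShimuraInertSavedDisplayAtD ((⟨0, 1, 0, -615785, 185776275⟩ : WeierstrassCurve ℤ).baseChange ℚ) 5 11) :
    Typed.MissingUpperBoundAt ((⟨0, 1, 0, -615785, 185776275⟩ : WeierstrassCurve ℤ).baseChange ℚ) 5 := by
  obtain ⟨-, -, -, -, -, hGZK, hmod, hnf, -, -, hMaz, -, hFH, -, -⟩ := h₅
  exact missingUpperBoundAt_of_classX11b_of_not_ram_of_upToOne₂_of_savedDisplayD hGZK hmod hnf hFH hMaz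
    Literature.NumberTheory.EllipticCurves.BarriosEtAl2025.localTamagawaNumber_quadraticTwist_two_mem_of_goodReduction_holds hJL hCO
    ((⟨0, 1, 0, -615785, 185776275⟩ : WeierstrassCurve ℤ).baseChange ℚ) 5 hX le_rfl not_ram_five (fun Wd _ _ hXa ↦ h₃ Wd 5 hXa) 11 split_eleven hSavD upToOneDatum₂_eleven

/-- **The same, with the typed display DERIVED as in the registered skeleton v10** — from the route item `ShimuraCasselsTateLevelInputs`, conjunct (2)
of the CITABLE stub `stub_printFactsHeld` (SelmerComplement of THE canonical local invariant maps ⟹ Poitou–Tate for Selmer structures, tam3-p1's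
`Koly.poitouTate_conj_forall_of_selmerComplement_canonical`) and the registered typed stub `stub_shimuraCarrierLabelsB6AtFive` (its TEXT VERBATIM as
the binder `hLabT`), by -w2's `shimuraInertSavedDisplayAtD_of_carrierLabelsB6_of_five_le` (p624474). So at this pair the crux's conclusion is a
kernel theorem modulo exactly {five route items, `stub_printFactsHeld`.2, `stub_shimuraCarrierLabelsB6AtFive`} and `ClassX11b E 5`. CONDITIONAL.
[cite: MilneADT2006, Ch. I Prop. 3.8, Thm. 4.10(b)] [cite: Jetchev2008, Thm. 1.1, Cor. 1.5] [cite: GrossZagier1986Heegner, III (3.1)] -/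
theorem missingUpperBoundAt_of_items_of_carrierLabelsB6 (h₅ : PublishedInputsFive) (h₃ : X11aLowerHalf)
    (hJL : ShimuraParametrizationDataNonempty) (hCO : PastenComponentOrdersInput) (hCTi : ShimuraCasselsTateLevelInputs)
    (hSC : ∀ (K : Type) [Field K] [NumberField K] (n : ℕ) [NeZero n],
      (Literature.NumberTheory.GaloisCohomology.LocalInvariants.canonical K n).SelmerComplement)
    (hLabT : ∀ (W : WeierstrassCurve ℚ) [W.IsElliptic] [W.IsGloballyMinimal] (p : ℕ) [Fact p.Prime],
      Summit.BirchSwinnertonDyer.Rank1Residual.ClassX11b W p → 5 ≤ p →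
      ∀ (N : ℕ) [NeZero N] (K : Type) [Field K] [NumberField K] (S : Finset ℕ)
        (Dt : Literature.NumberTheory.EllipticCurves.ModularForms.ModularParametrizationData W N)
        (X : Literature.NumberTheory.Automorphic.ShimuraCurveData (∏ q ∈ S, q) (N / ∏ q ∈ S, q)) (W' : WeierstrassCurve ℚ) [W'.IsElliptic]
        (P₀ : Literature.NumberTheory.Automorphic.ShimuraParametrizationData X W'),
        W.conductorNorm ℤ = N → Literature.NumberTheory.EllipticCurves.IsImaginaryQuadratic K → NumberField.discr K < -4 → Even S.card →
        (∀ ℓ ∈ S, ℓ.Prime ∧ ℓ ∣ N ∧ ¬ ℓ ^ 2 ∣ N ∧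
          ((Ideal.span {(ℓ : ℤ)}).primesOver (NumberField.RingOfIntegers K)).ncard = 1 ∧ ¬ (ℓ : ℤ) ∣ NumberField.discr K) →
        (∀ ℓ : ℕ, ℓ.Prime → ℓ ∣ N → ℓ ∉ S → ((Ideal.span {(ℓ : ℤ)}).primesOver (NumberField.RingOfIntegers K)).ncard = 2) →
        p ∈ S → ¬ (p : ℤ) ∣ Dt.c → P₀.IsMinimalFor W →
        ∃ (ι : K →+* ℂ) (y : (W.baseChange K).toAffine.Point) (degy : ℕ)
          (ys : (m : ℕ) → (W.baseChange (Literature.NumberTheory.EllipticCurves.ringClassField K ι m)).toAffine.Point) (ε : ℤ), 0 < degy ∧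
          padicValNat p degy = padicValNat p P₀.deg ∧
          Literature.NumberTheory.EllipticCurves.LDerivEK W K = 8 * (Real.pi : ℂ) ^ 2 *
              Literature.NumberTheory.EllipticCurves.ModularForms.peterssonProduct (CongruenceSubgroup.Gamma0 N) 2 Dt.f Dt.f /
              ((((NumberField.Units.torsionOrder K : ℝ) / 2) ^ 2 * √|(NumberField.discr K : ℝ)| : ℝ) : ℂ) *
            ((y.canonicalHeight : ℂ) / (degy : ℂ)) ∧
          (¬ IsOfFinAddOrder y → 0 < (AddSubgroup.zmultiples y).index) ∧
          Summit.BirchSwinnertonDyer.BirchSwinnertonDyer.Theorems.ShimuraWalk.LabelsAt W N K ι y ys ε ∧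
          ∀ (q : ℕ) [Fact q.Prime], q ∣ N → q ∉ S → p ∣ (W.baseChange ℚ_[q]).localTamagawaNumber ℤ_[q] →
            Literature.NumberTheory.EllipticCurves.ShimuraCMFamily.LabelB6 ι W N {q} ys)
    [Fact (Nat.Prime 5)] [((⟨0, 1, 0, -615785, 185776275⟩ : WeierstrassCurve ℤ).baseChange ℚ).IsElliptic] [((⟨0, 1, 0, -615785, 185776275⟩ : WeierstrassCurve ℤ).baseChange ℚ).IsGloballyMinimal] (hX : ClassX11b ((⟨0, 1, 0, -615785, 185776275⟩ : WeierstrassCurve ℤ).baseChange ℚ) 5) :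
    Typed.MissingUpperBoundAt ((⟨0, 1, 0, -615785, 185776275⟩ : WeierstrassCurve ℤ).baseChange ℚ) 5 := by
  haveI : Fact (Nat.Prime 11) := ⟨by norm_num⟩
  exact missingUpperBoundAt_of_items_of_savedDisplayAtD h₅ h₃ hJL hCO hX
    (shimuraInertSavedDisplayAtD_of_carrierLabelsB6_of_five_le
      (Summit.BirchSwinnertonDyer.Rank1Residual.X11b.Three.Koly.poitouTate_conj_forall_of_selmerComplement_canonical hSC) hCTi hLabT
      ((⟨0, 1, 0, -615785, 185776275⟩ : WeierstrassCurve ℤ).baseChange ℚ) 5 hX le_rfl 11)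

/-- **THE RUNG — the text of crux 19715 `EulerHalfNotRamNoInertSetAtFive` AT THE PAIR (129360cy1, 5), VERBATIM as conclusion** (the shape of the
registered rungs `stub_rung_res_8085y1` ∕ `stub_rung_res_605a1`, here for the ONE census pair of the up-to-one road), GIVEN the four route items and the
typed display at `q₁ = 11`. The binders `Surj`, `¬ Ram`, `5 ∣ ∏c`, «no inert datum» are not used (the last three are THEOREMS here: `binders_hold`).
CONDITIONAL on the items; a helper, not a closure of 19715; BSD(129360cy1, 5) is NOT proved by this. [cite: Cremona1997, Table 1 (curve 129360cy1)]
[cite: Jetchev2008, Cor. 1.5] [cite: PastenShimura2024, §6.6, Lemma 6.18] -/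
theorem rung_res_129360cy1_of_items_of_savedDisplayAtD (h₅ : PublishedInputsFive) (h₃ : X11aLowerHalf)
    (hJL : ShimuraParametrizationDataNonempty) (hCO : PastenComponentOrdersInput)
    [Fact (Nat.Prime 5)] [Fact (Nat.Prime 11)] [((⟨0, 1, 0, -615785, 185776275⟩ : WeierstrassCurve ℤ).baseChange ℚ).IsElliptic] [((⟨0, 1, 0, -615785, 185776275⟩ : WeierstrassCurve ℤ).baseChange ℚ).IsGloballyMinimal]
    (hSavD : ShimuraInertSavedDisplayAtD ((⟨0, 1, 0, -615785, 185776275⟩ : WeierstrassCurve ℤ).baseChange ℚ) 5 11) :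
    Summit.BirchSwinnertonDyer.Rank1Residual.ClassX11b ((⟨0, 1, 0, -615785, 185776275⟩ : WeierstrassCurve ℤ).baseChange ℚ) 5 → 5 ≤ 5 → Literature.NumberTheory.EllipticCurves.Rank1Residual.Surj ((⟨0, 1, 0, -615785, 185776275⟩ : WeierstrassCurve ℤ).baseChange ℚ) 5 → ¬ Literature.NumberTheory.EllipticCurves.Rank1Residual.Ram ((⟨0, 1, 0, -615785, 185776275⟩ : WeierstrassCurve ℤ).baseChange ℚ) 5 → 5 ∣ ((⟨0, 1, 0, -615785, 185776275⟩ : WeierstrassCurve ℤ).baseChange ℚ).tamagawaProduct → ¬ (∃ S : Finset ℕ, (∀ ℓ ∈ S, ∃ _ : Fact ℓ.Prime, Literature.NumberTheory.EllipticCurves.Rank1Residual.Mult ((⟨0, 1, 0, -615785, 185776275⟩ : WeierstrassCurve ℤ).baseChange ℚ) ℓ) ∧ Even S.card ∧ 5 ∈ S ∧ (∀ (ℓ : ℕ) [Fact ℓ.Prime], ℓ ∉ S → ((⟨0, 1, 0, -615785, 185776275⟩ : WeierstrassCurve ℤ).baseChange ℚ).HasSplitMultiplicativeReductionAtPrime ℓ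 → ¬ 5 ∣ padicValInt ℓ ((⟨0, 1, 0, -615785, 185776275⟩ : WeierstrassCurve ℤ).baseChange ℚ).minimalDiscriminantInt) ∧ (¬ 5 ∣ padicValInt 5 ((⟨0, 1, 0, -615785, 185776275⟩ : WeierstrassCurve ℤ).baseChange ℚ).minimalDiscriminantInt ∨ ∃ R ⊆ S, S.card = 2 * R.card ∧ ∀ q ∈ R, q ≠ 2 ∧ ¬ 5 ∣ q - 1)) → Literature.NumberTheory.EllipticCurves.Rank1Residual.Typed.MissingUpperBoundAt ((⟨0, 1, 0, -615785, 185776275⟩ : WeierstrassCurve ℤ).baseChange ℚ) 5 :=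
  fun hX _ _ _ _ _ ↦ missingUpperBoundAt_of_items_of_savedDisplayAtD h₅ h₃ hJL hCO hX hSavD

/-- **THE RUNG modulo the registered texts** — crux 19715's text at (129360cy1, 5) from the five route items `PublishedInputsFive`, `X11aLowerHalf`,
`ShimuraParametrizationDataNonempty`, `PastenComponentOrdersInput`, `ShimuraCasselsTateLevelInputs`, conjunct (2) of `stub_printFactsHeld` and the
registered stub text `stub_shimuraCarrierLabelsB6AtFive` (binder `hLabT`). CONDITIONAL; nothing booked; BSD(129360cy1, 5) is NOT proved by this.
[cite: Cremona1997, Table 1 (curve 129360cy1)] [cite: Jetchev2008, Cor. 1.5] [cite: MilneADT2006, Ch. I Thm. 4.10(b)] -/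
theorem rung_res_129360cy1_of_items_of_carrierLabelsB6 (h₅ : PublishedInputsFive) (h₃ : X11aLowerHalf)
    (hJL : ShimuraParametrizationDataNonempty) (hCO : PastenComponentOrdersInput) (hCTi : ShimuraCasselsTateLevelInputs)
    (hSC : ∀ (K : Type) [Field K] [NumberField K] (n : ℕ) [NeZero n],
      (Literature.NumberTheory.GaloisCohomology.LocalInvariants.canonical K n).SelmerComplement)
    (hLabT : ∀ (W : WeierstrassCurve ℚ) [W.IsElliptic] [W.IsGloballyMinimal] (p : ℕ) [Fact p.Prime],
      Summit.BirchSwinnertonDyer.Rank1Residual.ClassX11b W p → 5 ≤ p →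
      ∀ (N : ℕ) [NeZero N] (K : Type) [Field K] [NumberField K] (S : Finset ℕ)
        (Dt : Literature.NumberTheory.EllipticCurves.ModularForms.ModularParametrizationData W N)
        (X : Literature.NumberTheory.Automorphic.ShimuraCurveData (∏ q ∈ S, q) (N / ∏ q ∈ S, q)) (W' : WeierstrassCurve ℚ) [W'.IsElliptic]
        (P₀ : Literature.NumberTheory.Automorphic.ShimuraParametrizationData X W'),
        W.conductorNorm ℤ = N → Literature.NumberTheory.EllipticCurves.IsImaginaryQuadratic K → NumberField.discr K < -4 → Even S.card →
        (∀ ℓ ∈ S, ℓ.Prime ∧ ℓ ∣ N ∧ ¬ ℓ ^ 2 ∣ N ∧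
          ((Ideal.span {(ℓ : ℤ)}).primesOver (NumberField.RingOfIntegers K)).ncard = 1 ∧ ¬ (ℓ : ℤ) ∣ NumberField.discr K) →
        (∀ ℓ : ℕ, ℓ.Prime → ℓ ∣ N → ℓ ∉ S → ((Ideal.span {(ℓ : ℤ)}).primesOver (NumberField.RingOfIntegers K)).ncard = 2) →
        p ∈ S → ¬ (p : ℤ) ∣ Dt.c → P₀.IsMinimalFor W →
        ∃ (ι : K →+* ℂ) (y : (W.baseChange K).toAffine.Point) (degy : ℕ)
          (ys : (m : ℕ) → (W.baseChange (Literature.NumberTheory.EllipticCurves.ringClassField K ι m)).toAffine.Point) (ε : ℤ), 0 < degy ∧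
          padicValNat p degy = padicValNat p P₀.deg ∧
          Literature.NumberTheory.EllipticCurves.LDerivEK W K = 8 * (Real.pi : ℂ) ^ 2 *
              Literature.NumberTheory.EllipticCurves.ModularForms.peterssonProduct (CongruenceSubgroup.Gamma0 N) 2 Dt.f Dt.f /
              ((((NumberField.Units.torsionOrder K : ℝ) / 2) ^ 2 * √|(NumberField.discr K : ℝ)| : ℝ) : ℂ) *
            ((y.canonicalHeight : ℂ) / (degy : ℂ)) ∧
          (¬ IsOfFinAddOrder y → 0 < (AddSubgroup.zmultiples y).index) ∧
          Summit.BirchSwinnertonDyer.BirchSwinnertonDyer.Theorems.ShimuraWalk.LabelsAt W N K ι y ys ε ∧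
          ∀ (q : ℕ) [Fact q.Prime], q ∣ N → q ∉ S → p ∣ (W.baseChange ℚ_[q]).localTamagawaNumber ℤ_[q] →
            Literature.NumberTheory.EllipticCurves.ShimuraCMFamily.LabelB6 ι W N {q} ys)
    [Fact (Nat.Prime 5)] [((⟨0, 1, 0, -615785, 185776275⟩ : WeierstrassCurve ℤ).baseChange ℚ).IsElliptic] [((⟨0, 1, 0, -615785, 185776275⟩ : WeierstrassCurve ℤ).baseChange ℚ).IsGloballyMinimal] :
    Summit.BirchSwinnertonDyer.Rank1Residual.ClassX11b ((⟨0, 1, 0, -615785, 185776275⟩ : WeierstrassCurve ℤ).baseChange ℚ) 5 → 5 ≤ 5 → Literature.NumberTheory.EllipticCurves.Rank1Residual.Surj ((⟨0, 1, 0, -615785, 185776275⟩ : WeierstrassCurve ℤ).baseChange ℚ) 5 → ¬ Literature.NumberTheory.EllipticCurves.Rank1Residual.Ram ((⟨0, 1, 0, -615785, 185776275⟩ : WeierstrassCurve ℤ).baseChange ℚ) 5 → 5 ∣ ((⟨0, 1, 0, -615785, 185776275⟩ : WeierstrassCurve ℤ).baseChange ℚ).tamagawaProduct → ¬ (∃ S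 : Finset ℕ, (∀ ℓ ∈ S, ∃ _ : Fact ℓ.Prime, Literature.NumberTheory.EllipticCurves.Rank1Residual.Mult ((⟨0, 1, 0, -615785, 185776275⟩ : WeierstrassCurve ℤ).baseChange ℚ) ℓ) ∧ Even S.card ∧ 5 ∈ S ∧ (∀ (ℓ : ℕ) [Fact ℓ.Prime], ℓ ∉ S → ((⟨0, 1, 0, -615785, 185776275⟩ : WeierstrassCurve ℤ).baseChange ℚ).HasSplitMultiplicativeReductionAtPrime ℓ → ¬ 5 ∣ padicValInt ℓ ((⟨0, 1, 0, -615785, 185776275⟩ : WeierstrassCurve ℤ).baseChange ℚ).minimalDiscriminantInt) ∧ (¬ 5 ∣ padicValInt 5 ((⟨0, 1, 0, -615785, 185776275⟩ : WeierstrassCurve ℤ).baseChange ℚ).minimalDiscriminantInt ∨ ∃ R ⊆ S, S.card = 2 * R.card ∧ ∀ q ∈ R, q ≠ 2 ∧ ¬ 5 ∣ q - 1)) → Literature.NumberTheory.EllipticCurves.Rank1Residual.Typed.MissingUpperBoundAt ((⟨0, 1, 0, -615785, 185776275⟩ : WeierstrassCurve ℤ).baseChange ℚ) 5 :=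
  fun hX _ _ _ _ _ ↦ missingUpperBoundAt_of_items_of_carrierLabelsB6 h₅ h₃ hJL hCO hCTi hSC hLabT hX

/-- **The S2-shaped rung** (the shape of the registered `stub_rung_res_8085y1`: with the extra binder «a multiplicative prime `≠ 5`»), modulo the four
route items and the typed display at `q₁ = 11` — for the line card's bookkeeping of piece S2b′. CONDITIONAL. [cite: Cremona1997, Table 1 (curve 129360cy1)] -/
theorem rung_res_129360cy1_S2_of_items_of_savedDisplayAtD (h₅ : PublishedInputsFive) (h₃ : X11aLowerHalf)
    (hJL : ShimuraParametrizationDataNonempty) (hCO : PastenComponentOrdersInput)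
    [Fact (Nat.Prime 5)] [Fact (Nat.Prime 11)] [((⟨0, 1, 0, -615785, 185776275⟩ : WeierstrassCurve ℤ).baseChange ℚ).IsElliptic] [((⟨0, 1, 0, -615785, 185776275⟩ : WeierstrassCurve ℤ).baseChange ℚ).IsGloballyMinimal]
    (hSavD : ShimuraInertSavedDisplayAtD ((⟨0, 1, 0, -615785, 185776275⟩ : WeierstrassCurve ℤ).baseChange ℚ) 5 11) :
    Summit.BirchSwinnertonDyer.Rank1Residual.ClassX11b ((⟨0, 1, 0, -615785, 185776275⟩ : WeierstrassCurve ℤ).baseChange ℚ) 5 → 5 ≤ 5 → Literature.NumberTheory.EllipticCurves.Rank1Residual.Surj ((⟨0, 1, 0, -615785, 185776275⟩ : WeierstrassCurve ℤ).baseChange ℚ) 5 → ¬ Literature.NumberTheory.EllipticCurves.Rank1Residual.Ram ((⟨0, 1, 0, -615785, 185776275⟩ : WeierstrassCurve ℤ).baseChange ℚ) 5 → 5 ∣ ((⟨0, 1, 0, -615785, 185776275⟩ : WeierstrassCurve ℤ).baseChange ℚ).tamagawaProduct → (∃ ℓ : ℕ, ∃ _ : Fact ℓ.Prime, ℓ ≠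 5 ∧ ((⟨0, 1, 0, -615785, 185776275⟩ : WeierstrassCurve ℤ).baseChange ℚ).HasMultiplicativeReductionAtPrime ℓ) → ¬ (∃ S : Finset ℕ, (∀ ℓ ∈ S, ∃ _ : Fact ℓ.Prime, Literature.NumberTheory.EllipticCurves.Rank1Residual.Mult ((⟨0, 1, 0, -615785, 185776275⟩ : WeierstrassCurve ℤ).baseChange ℚ) ℓ) ∧ Even S.card ∧ 5 ∈ S ∧ (∀ (ℓ : ℕ) [Fact ℓ.Prime], ℓ ∉ S → ((⟨0, 1, 0, -615785, 185776275⟩ : WeierstrassCurve ℤ).baseChange ℚ).HasSplitMultiplicativeReductionAtPrime ℓ → ¬ 5 ∣ padicValInt ℓ ((⟨0, 1, 0, -615785, 185776275⟩ : WeierstrassCurve ℤ).baseChange ℚ).minimalDiscriminantInt) ∧ (¬ 5 ∣ padicValInt 5 ((⟨0, 1, 0, -615785, 185776275⟩ : WeierstrassCurve ℤ).baseChange ℚ).minimalDiscriminantInt ∨ ∃ R ⊆ S, S.card = 2 * R.card ∧ ∀ q ∈ R, q ≠ 2 ∧ ¬ 5 ∣ q - 1)) → Literature.NumberTheory.EllipticCurves.Rank1Residual.Typed.MissingUpperBoundAt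 ((⟨0, 1, 0, -615785, 185776275⟩ : WeierstrassCurve ℤ).baseChange ℚ) 5 :=
  fun hX _ _ _ _ _ _ ↦ missingUpperBoundAt_of_items_of_savedDisplayAtD h₅ h₃ hJL hCO hX hSavD

end Summit.BirchSwinnertonDyer.BirchSwinnertonDyer.Theorems.EulerHalfInertUpToOne.Rung129360cy1

end
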